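import Literature.Probability.Percolation.FivePointHolomorphyBdry
import Mathlib.RingTheory.RootsOfUnity.Complex
import HarnessLib

/-!
# Five-point observables: the unit sum `Σ_j F_j = 1` and the vanishing of discrete contour integrals

Topic `Literature/Probability/Percolation`; lane pcv-sawmu (CriticalPhenomena), door (v) / (v-d). Two formal consequences of the tree's
five-point theorems for the sparse observables `F_j = H_{j,A} − τ² H_{j+1,B} − τ H_{j−1,B}` (`sparseObs`) on a five-marked discrete domain:

* `sum_sparseObs_eq_one`: `Σ_{j : Fin 5} F_j(e) = 1` at every edge `e` of `H_G` (from the five-point normalisation `Σ_r (H_{r,A}+H_{r,B}) = 1`,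
  `Bdry.sum_midEdgeProb_eq_one'`, and `−τ² − τ = 1`) — the discrete form of `Σ_j f_j ≡ 1` of the lane's continuum dictionary;
* `contour_sum_eq_zero` (abstract telescoping: ANY bond-symmetric edge function whose `τ`-weighted three-term sum vanishes at every face of a
  finite face set `Λ` has vanishing `τ`-weighted sum over the edges LEAVING `Λ`, signed by the face orientation — because
  `ccwNbr (ccwNbr v k) k = v` with the opposite orientation, so inner edges cancel in pairs) and its instance `fivePointContour_eq_zero`:
  for every finite set `Λ` of interior faces, `Σ_{v ∈ Λ, k : ccwNbr v k ∉ Λ} ε(v) τ^k F_j(v, ccwNbr v k) = 0` — the five-point analogue of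
  Khristoforov–Smirnov's Corollary 5 (discrete contour integrals of `F` vanish), the input of the Morera argument of their §3;
  `contour_sum_eq_zero_of_holoAt` is the same with the vertex relation as a hypothesis predicate, and `fivePointContourAllSides_eq_zero`
  (via the boundary-vertex theorem (H∂), `FivePointHolomorphyBdry.lean`) covers every finite set of faces with three `H_G`-sides, i.e.
  contours running along `∂Ω`.

## References
* M. Khristoforov, S. Smirnov, *Percolation and O(1) loop model*, arXiv:2111.15612 (2021), §2 Lemma 4 and Corollary 5 (pp. 4–5), §3.
* B. Bollobás, O. Riordan, *Percolation*, Cambridge University Press (2006), Ch. 7 §7.2.2 pp. 168–171.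
-/

open Finset

namespace Literature.Probability.Percolation.FivePoint

open Finset Literature.Probability.Percolation Literature.Probability.LatticeModels Literature.Probability.Percolation.FivePoint TriMarkedDomain

namespace Contour

open N5 Bdry

variable (D : TriMarkedDomain 5)

/-! ## The unit sum `Σ_j F_j = 1` -/

/-- `τ² + τ + 1 = 0`. [folklore] -/
private theorem c_tau_sum : 1 + tau + tau ^ 2 = 0 := by
  have hprim : IsPrimitiveRoot tau 3 := by
    have h := Complex.isPrimitiveRoot_exp 3 (by norm_num)
    unfold tau
    convert h using 2
    push_cast
    ring
  have h := hprim.geom_sum_eq_zero (by norm_num : 1 < 3)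
  simp only [Finset.sum_range_succ, Finset.sum_range_zero, pow_zero, pow_one, zero_add] at h
  linear_combination h

/-- **`Σ_{j : Fin 5} F_j(e) = 1` at every edge of `H_G`** (adjacent faces whose common bond has an endpoint in `G`): the five-point
normalisation summed over the two patterns, with `−τ² − τ = 1`. [cite: KhristoforovSmirnov2021, §2 Definition 3 (p. 4), five-disorder analogue: Σ_j f_j ≡ 1] -/
theorem sum_sparseObs_eq_one {x x' : HexVertex} (hadj : hexGraph.Adj x x') (hG : ∃ g ∈ faceEdge x x', g ∈ D.verts) (c : Bool) :
    ∑ j : Fin 5, sparseObs D j c x x' = 1 := by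
  have hN := sum_midEdgeProb_eq_one' D hadj hG c
  simp only [midEdgeProb_eq_patternProb_add] at hN
  unfold sparseObs
  simp only [Finset.sum_sub_distrib, ← Finset.mul_sum]
  have h1 : ∑ j : Fin 5, (patternProb D (j + 1) c true x x' : ℂ) = ∑ j : Fin 5, (patternProb D j c true x x' : ℂ) :=
    Fintype.sum_equiv (Equiv.addRight 1) _ _ (fun _ => rfl)
  have h4 : ∑ j : Fin 5, (patternProb D (j + 4) c true x x' : ℂ) = ∑ j : Fin 5, (patternProb D j c true x x' : ℂ) :=
    Fintype.sum_equiv (Equiv.addRight 4) _ _ (fun _ => rfl)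
  rw [h1, h4]
  have hNc : ∑ j : Fin 5, ((patternProb D j c false x x' : ℂ) + (patternProb D j c true x x' : ℂ)) = 1 := by
    exact_mod_cast hN
  rw [Finset.sum_add_distrib] at hNc
  linear_combination hNc - (∑ j : Fin 5, (patternProb D j c true x x' : ℂ)) * c_tau_sum

/-! ## Discrete contour integrals: the telescoping lemma -/

/-- the orientation sign of a face: `+1` for up triangles, `−1` for down triangles (the three edges at a down face point opposite to
those at an up face). [folklore] -/
noncomputable def sgn (v : HexVertex) : ℂ := if v.2 = 0 then 1 else -1

/-- crossing the `k`-th counter-clockwise edge twice returns to the face. [cite: BollobasRiordan2006, Ch. 7 §7.2.2 pp. 168–171 (the hexagonal lattice and its faces)] -/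
theorem ccwNbr_ccwNbr (v : HexVertex) (k : Fin 3) : ccwNbr (ccwNbr v k) k = v := by
  obtain ⟨x, t⟩ := v
  have ht : t = 0 ∨ t = 1 := by
    rcases Fin.exists_fin_two.1 ⟨t, rfl⟩ with h | h
    · exact Or.inl h
    · exact Or.inr h
  rcases ht with rfl | rfl <;> fin_cases k <;> simp [ccwNbr]

/-- the neighbour across an edge has the opposite orientation. [cite: BollobasRiordan2006, Ch. 7 §7.2.2 pp. 168–171 (the hexagonal lattice and its faces)] -/
theorem ccwNbr_snd_ne (v : HexVertex) (k : Fin 3) : (ccwNbr v k).2 ≠ v.2 := by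
  obtain ⟨x, t⟩ := v
  have ht : t = 0 ∨ t = 1 := by
    rcases Fin.exists_fin_two.1 ⟨t, rfl⟩ with h | h
    · exact Or.inl h
    · exact Or.inr h
  rcases ht with rfl | rfl <;> fin_cases k <;> simp [ccwNbr]

/-- … hence the opposite sign. [cite: BollobasRiordan2006, Ch. 7 §7.2.2 pp. 168–171 (the hexagonal lattice and its faces)] -/
theorem sgn_ccwNbr (v : HexVertex) (k : Fin 3) : sgn (ccwNbr v k) = - sgn v := by
  have h := ccwNbr_snd_ne v k
  unfold sgn
  by_cases hv : v.2 = 0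
  · have : (ccwNbr v k).2 ≠ 0 := by rw [hv] at h; exact h
    rw [if_neg this, if_pos hv]
  · have hv1 : v.2 = 1 := by
      rcases Fin.exists_fin_two.1 ⟨v.2, rfl⟩ with h' | h'
      · exact absurd h' hv
      · exact h'
    have : (ccwNbr v k).2 = 0 := by
      rcases Fin.exists_fin_two.1 ⟨(ccwNbr v k).2, rfl⟩ with h' | h'
      · exact h'
      · exact absurd (h'.trans hv1.symm) h
    rw [if_pos this, if_neg hv]
    ring

/-- a face is not its own neighbour. [cite: BollobasRiordan2006, Ch. 7 §7.2.2 pp. 168–171 (the hexagonal lattice and its faces)] -/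
theorem ccwNbr_ne (v : HexVertex) (k : Fin 3) : ccwNbr v k ≠ v := fun e => ccwNbr_snd_ne v k (by rw [e])

/-- **the telescoping lemma (discrete Green/contour identity)**: for a bond-symmetric edge function `F` whose `τ`-weighted three-term sum
vanishes at every face of the finite set `Λ`, the signed `τ`-weighted sum of `F` over the edges LEAVING `Λ` vanishes — the edges with both
faces in `Λ` cancel in pairs. [cite: KhristoforovSmirnov2021, §2 Corollary 5 (p. 5)] -/
theorem contour_sum_eq_zero (F : HexVertex → HexVertex → ℂ) (hF : ∀ v w, F v w = F w v) (Λ : Finset HexVertex)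
    (hrel : ∀ v ∈ Λ, ∑ k : Fin 3, tau ^ (k : ℕ) * F v (ccwNbr v k) = 0) :
    ∑ v ∈ Λ, ∑ k ∈ (Finset.univ : Finset (Fin 3)).filter (fun k => ccwNbr v k ∉ Λ),
      sgn v * tau ^ (k : ℕ) * F v (ccwNbr v k) = 0 := by
  classical
  -- the total signed sum vanishes face by face
  have htot : ∑ v ∈ Λ, ∑ k : Fin 3, sgn v * tau ^ (k : ℕ) * F v (ccwNbr v k) = 0 := by
    refine Finset.sum_eq_zero fun v hv => ?_
    have : ∑ k : Fin 3, sgn v * tau ^ (k : ℕ) * F v (ccwNbr v k) = sgn v * ∑ k : Fin 3, tau ^ (k : ℕ) * F v (ccwNbr v k) := by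
      rw [Finset.mul_sum]
      refine Finset.sum_congr rfl fun k _ => ?_
      ring
    rw [this, hrel v hv, mul_zero]
  -- the inner edges cancel in pairs
  have hinner : ∑ v ∈ Λ, ∑ k ∈ (Finset.univ : Finset (Fin 3)).filter (fun k => ccwNbr v k ∈ Λ),
      sgn v * tau ^ (k : ℕ) * F v (ccwNbr v k) = 0 := by
    rw [← Finset.sum_finset_product' ((Λ ×ˢ (Finset.univ : Finset (Fin 3))).filter fun q => ccwNbr q.1 q.2 ∈ Λ) Λ
      (fun v => (Finset.univ : Finset (Fin 3)).filter (fun k => ccwNbr v k ∈ Λ))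
      (by intro q; rw [Finset.mem_filter, Finset.mem_product, Finset.mem_filter]; simp)]
    refine Finset.sum_involution (fun q _ => (ccwNbr q.1 q.2, q.2)) ?_ ?_ ?_ ?_
    · intro q hq
      simp only
      rw [ccwNbr_ccwNbr, sgn_ccwNbr, hF (ccwNbr q.1 q.2) q.1]
      ring
    · intro q hq _ h
      exact ccwNbr_ne q.1 q.2 (congrArg Prod.fst h)
    · intro q hq
      rw [Finset.mem_filter, Finset.mem_product] at hq ⊢
      exact ⟨⟨hq.2, Finset.mem_univ _⟩, by rw [ccwNbr_ccwNbr]; exact hq.1.1⟩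
    · intro q hq
      simp only [ccwNbr_ccwNbr]
  -- split the total
  have hsplit : ∀ v ∈ Λ, ∑ k : Fin 3, sgn v * tau ^ (k : ℕ) * F v (ccwNbr v k) =
      ∑ k ∈ (Finset.univ : Finset (Fin 3)).filter (fun k => ccwNbr v k ∈ Λ), sgn v * tau ^ (k : ℕ) * F v (ccwNbr v k) +
      ∑ k ∈ (Finset.univ : Finset (Fin 3)).filter (fun k => ccwNbr v k ∉ Λ), sgn v * tau ^ (k : ℕ) * F v (ccwNbr v k) :=
    fun v _ => (Finset.sum_filter_add_sum_filter_not _ _ _).symm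
  rw [Finset.sum_congr rfl hsplit, Finset.sum_add_distrib, hinner, zero_add] at htot
  exact htot

/-- the relation at a face, as a predicate (discharged by the tree's (H) at interior faces, and by (H∂) at boundary valence-3 faces). [cite: KhristoforovSmirnov2021, §2 Lemma 4 (p. 4)] -/
def HoloAt (c : Bool) (j : Fin 5) (v : HexVertex) : Prop :=
  ∑ k : Fin 3, tau ^ (k : ℕ) * sparseObs D j c v (ccwNbr v k) = 0

/-- `sparseObs` is symmetric in the two faces of the edge. [cite: KhristoforovSmirnov2021, §2 Definition 3 (p. 4)] -/
theorem sparseObs_comm (j : Fin 5) (c : Bool) (x x' : HexVertex) : sparseObs D j c x x' = sparseObs D j c x' x := by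
  unfold sparseObs
  rw [patternProb_comm j c false x x', patternProb_comm (j + 1) c true x x', patternProb_comm (j + 4) c true x x']

/-- **discrete contour integrals of `F_j` vanish** around every finite set of faces at each of which the three-term relation holds. [cite: KhristoforovSmirnov2021, §2 Corollary 5 (p. 5), five-disorder analogue] -/
theorem contour_sum_eq_zero_of_holoAt (c : Bool) (j : Fin 5) (Λ : Finset HexVertex) (hΛ : ∀ v ∈ Λ, HoloAt D c j v) :
    ∑ v ∈ Λ, ∑ k ∈ (Finset.univ : Finset (Fin 3)).filter (fun k => ccwNbr v k ∉ Λ),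
      sgn v * tau ^ (k : ℕ) * sparseObs D j c v (ccwNbr v k) = 0 :=
  contour_sum_eq_zero (fun x x' => sparseObs D j c x x') (sparseObs_comm D j c) Λ hΛ

/-- ★ **the five-point analogue of Khristoforov–Smirnov's Corollary 5**: for every finite set `Λ` of INTERIOR faces of a five-marked domain,
the signed `τ`-weighted sum of `F_j` over the edges leaving `Λ` vanishes. [cite: KhristoforovSmirnov2021, §2 Corollary 5 (p. 5), five-disorder analogue] -/
theorem fivePointContour_eq_zero (c : Bool) (j : Fin 5) (Λ : Finset HexVertex) (hΛ : ∀ v ∈ Λ, hexFaceVertices v ⊆ D.verts) :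
    ∑ v ∈ Λ, ∑ k ∈ (Finset.univ : Finset (Fin 3)).filter (fun k => ccwNbr v k ∉ Λ),
      sgn v * tau ^ (k : ℕ) * sparseObs D j c v (ccwNbr v k) = 0 :=
  contour_sum_eq_zero_of_holoAt D c j Λ fun v hv => hexFivePointHolomorphy_holds D c j v (hΛ v hv)

/-- ★ **… and around every finite set of faces each of which has its three sides in `H_G`** (interior AND boundary valence-3 vertices;
contours may run along `∂Ω`), by the boundary-vertex theorem (H∂) `BdryH.hexFivePointHolomorphy_allSides`. [cite: KhristoforovSmirnov2021, §2 Corollary 5 (p. 5), five-disorder analogue] -/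
theorem fivePointContourAllSides_eq_zero (c : Bool) (j : Fin 5) (Λ : Finset HexVertex) (hΛ : ∀ v ∈ Λ, BdryH.AllSides D v) :
    ∑ v ∈ Λ, ∑ k ∈ (Finset.univ : Finset (Fin 3)).filter (fun k => ccwNbr v k ∉ Λ),
      sgn v * tau ^ (k : ℕ) * sparseObs D j c v (ccwNbr v k) = 0 :=
  contour_sum_eq_zero_of_holoAt D c j Λ fun v hv => BdryH.hexFivePointHolomorphy_allSides D c j v (hΛ v hv)

open Classical in
/-- the faces of `𝕋` touching `G` with all three sides in `H_G` (= all valence-3 vertices of `H_G`, interior and boundary). [cite: KhristoforovSmirnov2021, §2 Definition 3 (p. 4): the mid-edges of Ω] -/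
noncomputable def allSidesFaces (D : TriMarkedDomain 5) : Finset HexVertex :=
  (triFacesTouching D.verts).filter fun v => BdryH.AllSides D v

/-- ★ **the global discrete contour identity of a five-marked domain**: summed over ALL valence-3 vertices of `H_G`, the signed `τ`-weighted
five-point observable over the edges leaving them (the edges of `H_G` into the valence-2 boundary vertices, among them the ten corner edges)
vanishes — the discrete `∮_{∂Ω} F_j dz = 0`. [cite: KhristoforovSmirnov2021, §2 Corollary 5 (p. 5), five-disorder analogue] -/
theorem fivePointGlobalContour_eq_zero (c : Bool) (j : Fin 5) :
    ∑ v ∈ allSidesFaces D, ∑ k ∈ (Finset.univ : Finset (Fin 3)).filter (fun k => ccwNbr v k ∉ allSidesFaces D),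
      sgn v * tau ^ (k : ℕ) * sparseObs D j c v (ccwNbr v k) = 0 := by
  classical
  exact fivePointContourAllSides_eq_zero D c j _ fun v hv => by
    unfold allSidesFaces at hv
    exact (Finset.mem_filter.1 hv).2

end Contour

end Literature.Probability.Percolation.FivePoint
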